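import Summits.NavierStokesRegularity.NavierStokesRegularity.Theorems.SoloRefuteHaitani2025B0Spline

/-!
# C133 `Haitani2025` — B₀, file F1b: exact one-dimensional integrals of the mother spline

Towards the case-(α) ADDENDUM `¬ Step1_Display13 B₀` (chair 2026-08-27T05:18:12Z). Pure 1-D calculus
over `import …SoloRefuteHaitani2025B0Spline` (F1a): a small Horner-form polynomial kit `pl`, then, with exact
rational values,
* the vanishing moments `∫₀¹ xⁿ sp = 0` for `n ≤ 6` (the design property that makes the dyadic family
  orthogonal across levels) and its polynomial form `∫₀¹ p(y) sp(y) dy = 0` for `natDegree p ≤ 6`;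
* `∫₀¹ sp² = 1/30030`, `∫₀¹ dsp² = 2/77`;
* the substitution lemmas and the scaled norms `∫₀¹ spS k j ² = 1/(30030·2^k)`, `∫₀¹ dspS k j ² = 2/(77·2^k)`;
* the kill constants `∫₀¹ spS k j ² · spS (k+1) (2j) = M₀/2^k`, `∫₀¹ spS k j · dspS k j · spS (k+1) (2j) = N₀/2^k`
  with `M₀ = −1691/160592560128`, `N₀ = −21313/44609044480` (both nonzero — this is what kills (13)).
Exact values cross-checked in rational arithmetic (claims/Haitani2025/UG-AUDIT-C133-spline-check.py, B0/gen.py).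
[cite: Haitani2025NavierStokesGitHub, Definition 1 p.2; (13) p.4]

WHAT THIS IS NOT: not a claim about NS regularity or blow-up; not a claim about any author beyond the typed locator.
-/

set_option linter.dupNamespace false

open Set Filter Topology intervalIntegral MeasureTheory Polynomial

namespace Summit.NavierStokesRegularity.NavierStokesRegularity.Theorems.Haitani2025.B0

noncomputable section

/-! ### A Horner-form polynomial kit -/

/-- Horner evaluation of a coefficient list: `pl [c₀,c₁,…] x = c₀ + x (c₁ + x (…))`. [folklore] -/
def pl : List ℝ → ℝ → ℝ
  | [], _ => 0
  | c :: l, x => c + x * pl l x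

/-- `∫ₐᵇ x^m · pl l x`, in closed form. [folklore] -/
def plInt : List ℝ → ℕ → ℝ → ℝ → ℝ
  | [], _, _, _ => 0
  | c :: l, m, a, b => c * ((b ^ (m + 1) - a ^ (m + 1)) / (m + 1)) + plInt l (m + 1) a b

/-- `pl_nil` (1-D integral kit for B₀). [folklore] -/
@[simp] theorem pl_nil (x : ℝ) : pl [] x = 0 := rfl
/-- `pl_cons` (1-D integral kit for B₀). [folklore] -/
@[simp] theorem pl_cons (c : ℝ) (l : List ℝ) (x : ℝ) : pl (c :: l) x = c + x * pl l x := rfl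
/-- `plInt_nil` (1-D integral kit for B₀). [folklore] -/
@[simp] theorem plInt_nil (m : ℕ) (a b : ℝ) : plInt [] m a b = 0 := rfl
/-- `plInt_cons` (1-D integral kit for B₀). [folklore] -/
@[simp] theorem plInt_cons (c : ℝ) (l : List ℝ) (m : ℕ) (a b : ℝ) :
    plInt (c :: l) m a b = c * ((b ^ (m + 1) - a ^ (m + 1)) / (m + 1)) + plInt l (m + 1) a b := rfl

/-- `pl l` is continuous. [folklore] -/
theorem continuous_pl : ∀ l : List ℝ, Continuous (pl l)
  | [] => by show Continuous fun _ : ℝ => (0:ℝ); exact continuous_const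
  | c :: l => by
    have ih := continuous_pl l
    show Continuous fun x => c + x * pl l x
    fun_prop

/-- `∫ₐᵇ x^m · pl l x = plInt l m a b`. [folklore] -/
theorem integral_pow_mul_pl : ∀ (l : List ℝ) (m : ℕ) (a b : ℝ),
    ∫ x in a..b, x ^ m * pl l x = plInt l m a b
  | [], m, a, b => by simp
  | c :: l, m, a, b => by
    have ih := integral_pow_mul_pl l (m + 1) a b
    have e : (fun x : ℝ => x ^ m * pl (c :: l) x) = fun x => c * x ^ m + x ^ (m + 1) * pl l x := by
      funext x; simp only [pl_cons]; ring
    have i1 : IntervalIntegrable (fun x : ℝ => c * x ^ m) volume a b :=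
      (continuous_const.mul (continuous_pow m)).intervalIntegrable a b
    have i2 : IntervalIntegrable (fun x : ℝ => x ^ (m + 1) * pl l x) volume a b :=
      ((continuous_pow (m + 1)).mul (continuous_pl l)).intervalIntegrable a b
    rw [show (∫ x in a..b, x ^ m * pl (c :: l) x) = ∫ x in a..b, c * x ^ m + x ^ (m + 1) * pl l x by rw [e],
      integral_add i1 i2, intervalIntegral.integral_const_mul, integral_pow, ih, plInt_cons]

/-- `∫ₐᵇ pl l x = plInt l 0 a b`. [folklore] -/
theorem integral_pl (l : List ℝ) (a b : ℝ) : ∫ x in a..b, pl l x = plInt l 0 a b := by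
  simpa using integral_pow_mul_pl l 0 a b

/-- Transport an integral to the kit along a pointwise identity on the interval. [folklore] -/
theorem integral_eq_plInt {f : ℝ → ℝ} (l : List ℝ) {a b : ℝ} (h : ∀ x ∈ uIcc a b, f x = pl l x) :
    ∫ x in a..b, f x = plInt l 0 a b := by
  rw [integral_congr fun x hx => h x hx, integral_pl]

/-- Same with a monomial weight. [folklore] -/
theorem integral_pow_mul_eq_plInt {f : ℝ → ℝ} (l : List ℝ) (m : ℕ) {a b : ℝ}
    (h : ∀ x ∈ uIcc a b, f x = pl l x) : ∫ x in a..b, x ^ m * f x = plInt l m a b := by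
  rw [← integral_pow_mul_pl l m a b]
  exact integral_congr fun x hx => by simp [h x hx]

/-! ### The pieces in Horner form (coefficient lists generated by B0/gen.py, identities checked by `ring`) -/

/-- coefficients of `P`. [folklore] -/
def lP : List ℝ := [0, 0, -1, 20, -125, 306, -256]
/-- coefficients of `Q`. [folklore] -/
def lQ : List ℝ := [56, -448, 1471, -2540, 2435, -1230, 256]
/-- coefficients of `P²`. [folklore] -/
def lP2 : List ℝ := [0, 0, 0, 0, 1, -40, 650, -5612, 28377, -86740, 157636, -156672, 65536]
/-- coefficients of `Q²`. [folklore] -/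
def lQ2 : List ℝ := [3136, -50176, 365456, -1602496, 4712401, -9792200, 14746122, -16217836, 12930777,
  -7290580, 2759620, -629760, 65536]
/-- coefficients of `dP²`. [folklore] -/
def ldP2 : List ℝ := [0, 0, 4, -240, 5600, -66120, 439744, -1714320, 3876900, -4700160, 2359296]
/-- coefficients of `dQ²`. [folklore] -/
def ldQ2 : List ℝ := [200704, -2636032, 15482884, -53563120, 120884960, -186000456, 197631424, -143210640,
  67743780, -18892800, 2359296]
/-- coefficients of `P(y)² P(2y)`. [folklore] -/
def lPPP2 : List ℝ := [0, 0, 0, 0, 0, 0, -4, 320, -11000, 216240, -2719492, 23131440, -136865248, 569143040,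
  -1654888512, 3288549632, -4247912448, 3208642560, -1073741824]
/-- coefficients of `P(y)² Q(2y)`. [folklore] -/
def lPPQ2 : List ℝ := [0, 0, 0, 0, 56, -3136, 78124, -1152352, 11293824, -78110000, 394467548, -1481897168,
  4171240992, -8771997952, 13589702592, -15061333760, 11302600704, -5146411008, 1073741824]
/-- coefficients of `P(y) dP(y) P(2y)`. [folklore] -/
def lPdPP2 : List ℝ := [0, 0, 0, 0, 0, -8, 720, -27800, 610152, -8508720, 79739400, -516904784, 2343500448,
  -7397630656, 15899331840, -22137700352, 17968398336, -6442450944]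
/-- coefficients of `P(y) dP(y) Q(2y)`. [folklore] -/
def lPdPQ2 : List ℝ := [0, 0, 0, 112, -7392, 210568, -3476192, 37539400, -282733896, 1540821040, -6201291256,
  18590586032, -41435104608, 67753942336, -78979756800, 62149591040, -29595009024, 6442450944]

/-- `P_eq_pl` (1-D integral kit for B₀). [folklore] -/
theorem P_eq_pl (x : ℝ) : P x = pl lP x := by simp only [P, lP, pl_cons, pl_nil]; ring
/-- `Q_eq_pl` (1-D integral kit for B₀). [folklore] -/
theorem Q_eq_pl (x : ℝ) : Q x = pl lQ x := by simp only [Q, lQ, pl_cons, pl_nil]; ring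
/-- `P_sq_eq_pl` (1-D integral kit for B₀). [folklore] -/
theorem P_sq_eq_pl (x : ℝ) : P x ^ 2 = pl lP2 x := by simp only [P, lP2, pl_cons, pl_nil]; ring
/-- `Q_sq_eq_pl` (1-D integral kit for B₀). [folklore] -/
theorem Q_sq_eq_pl (x : ℝ) : Q x ^ 2 = pl lQ2 x := by simp only [Q, lQ2, pl_cons, pl_nil]; ring
/-- `dP_sq_eq_pl` (1-D integral kit for B₀). [folklore] -/
theorem dP_sq_eq_pl (x : ℝ) : dP x ^ 2 = pl ldP2 x := by simp only [dP, ldP2, pl_cons, pl_nil]; ring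
/-- `dQ_sq_eq_pl` (1-D integral kit for B₀). [folklore] -/
theorem dQ_sq_eq_pl (x : ℝ) : dQ x ^ 2 = pl ldQ2 x := by simp only [dQ, ldQ2, pl_cons, pl_nil]; ring
/-- `PPP2_eq_pl` (1-D integral kit for B₀). [folklore] -/
theorem PPP2_eq_pl (x : ℝ) : P x ^ 2 * P (2 * x) = pl lPPP2 x := by
  simp only [P, lPPP2, pl_cons, pl_nil]; ring
/-- `PPQ2_eq_pl` (1-D integral kit for B₀). [folklore] -/
theorem PPQ2_eq_pl (x : ℝ) : P x ^ 2 * Q (2 * x) = pl lPPQ2 x := by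
  simp only [P, Q, lPPQ2, pl_cons, pl_nil]; ring
/-- `PdPP2_eq_pl` (1-D integral kit for B₀). [folklore] -/
theorem PdPP2_eq_pl (x : ℝ) : P x * dP x * P (2 * x) = pl lPdPP2 x := by
  simp only [P, dP, lPdPP2, pl_cons, pl_nil]; ring
/-- `PdPQ2_eq_pl` (1-D integral kit for B₀). [folklore] -/
theorem PdPQ2_eq_pl (x : ℝ) : P x * dP x * Q (2 * x) = pl lPdPQ2 x := by
  simp only [P, dP, Q, lPdPQ2, pl_cons, pl_nil]; ring

/-! ### Pointwise forms of `sp`, `dsp` on the closed half intervals -/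

/-- `dsp = dP` on `[0,½]` (including the knot `0`). [folklore] -/
theorem dsp_eq_dP {x : ℝ} (h0 : 0 ≤ x) (h : x ≤ 1 / 2) : dsp x = dP x := by
  rcases eq_or_lt_of_le h0 with h0' | h0'
  · subst h0'; rw [dsp_of_nonpos le_rfl, dP_zero]
  · exact dsp_of_mem_left h0' h

/-- `dsp = dQ` on `[½,1]` (including the knot `½`). [folklore] -/
theorem dsp_eq_dQ {x : ℝ} (h : 1 / 2 ≤ x) (h1 : x ≤ 1) : dsp x = dQ x := by
  rcases eq_or_lt_of_le h with h' | h'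
  · subst h'; rw [dsp_eq_dP (by norm_num) le_rfl, dP_half, dQ_half]
  · exact dsp_of_mem_right h' h1

/-- `mem_Icc_of_uIcc` (1-D integral kit for B₀). [folklore] -/
theorem mem_Icc_of_uIcc {a b x : ℝ} (hab : a ≤ b) (hx : x ∈ uIcc a b) : a ≤ x ∧ x ≤ b := by
  rw [uIcc_of_le hab] at hx; exact hx

/-! ### Vanishing moments -/

/-- Left and right half of the `n`-th moment. [folklore] -/
theorem integral_pow_mul_sp_halves (n : ℕ) :
    (∫ x in (0:ℝ)..(1/2), x ^ n * sp x) = plInt lP n 0 (1/2) ∧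
    (∫ x in (1/2:ℝ)..1, x ^ n * sp x) = plInt lQ n (1/2) 1 := by
  constructor
  · refine integral_pow_mul_eq_plInt lP n fun x hx => ?_
    obtain ⟨h0, h1⟩ := mem_Icc_of_uIcc (by norm_num) hx
    rw [sp_of_mem_left h0 h1, P_eq_pl]
  · refine integral_pow_mul_eq_plInt lQ n fun x hx => ?_
    obtain ⟨h0, h1⟩ := mem_Icc_of_uIcc (by norm_num) hx
    rw [sp_of_mem_right h0 h1, Q_eq_pl]

/-- `intervalIntegrable_pow_mul_sp` (1-D integral kit for B₀). [folklore] -/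
theorem intervalIntegrable_pow_mul_sp (n : ℕ) (a b : ℝ) :
    IntervalIntegrable (fun x : ℝ => x ^ n * sp x) volume a b :=
  ((continuous_pow n).mul continuous_sp).intervalIntegrable a b

/-- **Vanishing moments**: `∫₀¹ xⁿ sp(x) dx = 0` for `n ≤ 6`. [folklore] -/
theorem integral_pow_mul_sp {n : ℕ} (hn : n ≤ 6) : ∫ x in (0:ℝ)..1, x ^ n * sp x = 0 := by
  rw [← integral_add_adjacent_intervals (intervalIntegrable_pow_mul_sp n 0 (1/2))
    (intervalIntegrable_pow_mul_sp n (1/2) 1), (integral_pow_mul_sp_halves n).1,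
    (integral_pow_mul_sp_halves n).2]
  interval_cases n <;> simp [lP, lQ] <;> norm_num

/-- Polynomial form: every polynomial of degree `≤ 6` is orthogonal to `sp` on `[0,1]`. [folklore] -/
theorem integral_polynomial_mul_sp (p : ℝ[X]) (hp : p.natDegree ≤ 6) :
    ∫ y in (0:ℝ)..1, p.eval y * sp y = 0 := by
  have e : ∀ y : ℝ, p.eval y * sp y = ∑ i ∈ Finset.range 7, p.coeff i * (y ^ i * sp y) := by
    intro y
    conv_lhs => rw [p.as_sum_range' 7 (by omega)]
    simp [eval_finsetSum, eval_monomial, Finset.sum_mul, mul_assoc]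
  simp_rw [e]
  rw [integral_finsetSum fun i _ => (intervalIntegrable_pow_mul_sp i 0 1).const_mul _]
  refine Finset.sum_eq_zero fun i hi => ?_
  have hi' : i ≤ 6 := by have := Finset.mem_range.1 hi; omega
  rw [intervalIntegral.integral_const_mul, integral_pow_mul_sp hi', mul_zero]

/-! ### Norms -/

/-- `‖sp‖² = 1/30030`. [folklore] -/
theorem integral_sp_sq : ∫ x in (0:ℝ)..1, sp x ^ 2 = 1 / 30030 := by
  have i : ∀ a b : ℝ, IntervalIntegrable (fun x => sp x ^ 2) volume a b := fun a b =>
    (continuous_sp.pow 2).intervalIntegrable a b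
  rw [← integral_add_adjacent_intervals (i 0 (1/2)) (i (1/2) 1)]
  rw [integral_eq_plInt lP2 fun x hx => by
      obtain ⟨h0, h1⟩ := mem_Icc_of_uIcc (by norm_num) hx; rw [sp_of_mem_left h0 h1, P_sq_eq_pl],
    integral_eq_plInt lQ2 fun x hx => by
      obtain ⟨h0, h1⟩ := mem_Icc_of_uIcc (by norm_num) hx; rw [sp_of_mem_right h0 h1, Q_sq_eq_pl]]
  simp [lP2, lQ2]; norm_num

/-- `‖dsp‖² = 2/77` (so `‖sp'‖²/‖sp‖² = 780`). [folklore] -/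
theorem integral_dsp_sq : ∫ x in (0:ℝ)..1, dsp x ^ 2 = 2 / 77 := by
  have i : ∀ a b : ℝ, IntervalIntegrable (fun x => dsp x ^ 2) volume a b := fun a b =>
    (continuous_dsp.pow 2).intervalIntegrable a b
  rw [← integral_add_adjacent_intervals (i 0 (1/2)) (i (1/2) 1)]
  rw [integral_eq_plInt ldP2 fun x hx => by
      obtain ⟨h0, h1⟩ := mem_Icc_of_uIcc (by norm_num) hx; rw [dsp_eq_dP h0 h1, dP_sq_eq_pl],
    integral_eq_plInt ldQ2 fun x hx => by
      obtain ⟨h0, h1⟩ := mem_Icc_of_uIcc (by norm_num) hx; rw [dsp_eq_dQ h0 h1, dQ_sq_eq_pl]]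
  simp [ldP2, ldQ2]; norm_num

/-! ### Raw kill constants -/

/-- `M₀ = ∫₀¹ sp(y)² sp(2y) dy = −1691/160592560128`. [folklore] -/
theorem integral_sp_sq_mul_sp_two_mul :
    ∫ y in (0:ℝ)..1, sp y ^ 2 * sp (2 * y) = -1691 / 160592560128 := by
  have hc : Continuous fun y : ℝ => sp y ^ 2 * sp (2 * y) :=
    (continuous_sp.pow 2).mul (continuous_sp.comp (continuous_const.mul continuous_id))
  have i : ∀ a b : ℝ, IntervalIntegrable (fun y : ℝ => sp y ^ 2 * sp (2 * y)) volume a b :=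
    fun a b => hc.intervalIntegrable a b
  rw [← integral_add_adjacent_intervals (i 0 (1/2)) (i (1/2) 1),
    ← integral_add_adjacent_intervals (i 0 (1/4)) (i (1/4) (1/2))]
  rw [integral_eq_plInt lPPP2 fun x hx => by
      obtain ⟨h0, h1⟩ := mem_Icc_of_uIcc (by norm_num) hx
      rw [sp_of_mem_left h0 (by linarith), sp_of_mem_left (by linarith) (by linarith), PPP2_eq_pl],
    integral_eq_plInt lPPQ2 fun x hx => by
      obtain ⟨h0, h1⟩ := mem_Icc_of_uIcc (by norm_num) hx
      rw [sp_of_mem_left (by linarith) h1, sp_of_mem_right (by linarith) (by linarith), PPQ2_eq_pl],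
    integral_eq_plInt [] fun x hx => by
      obtain ⟨h0, h1⟩ := mem_Icc_of_uIcc (by norm_num) hx
      rw [sp_of_one_le (x := 2 * x) (by linarith), mul_zero, pl_nil]]
  simp [lPPP2, lPPQ2]; norm_num

/-- `N₀ = ∫₀¹ sp(y) sp'(y) sp(2y) dy = −21313/44609044480`. [folklore] -/
theorem integral_sp_dsp_mul_sp_two_mul :
    ∫ y in (0:ℝ)..1, sp y * dsp y * sp (2 * y) = -21313 / 44609044480 := by
  have hc : Continuous fun y : ℝ => sp y * dsp y * sp (2 * y) :=
    (continuous_sp.mul continuous_dsp).mul (continuous_sp.comp (continuous_const.mul continuous_id))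
  have i : ∀ a b : ℝ, IntervalIntegrable (fun y : ℝ => sp y * dsp y * sp (2 * y)) volume a b :=
    fun a b => hc.intervalIntegrable a b
  rw [← integral_add_adjacent_intervals (i 0 (1/2)) (i (1/2) 1),
    ← integral_add_adjacent_intervals (i 0 (1/4)) (i (1/4) (1/2))]
  rw [integral_eq_plInt lPdPP2 fun x hx => by
      obtain ⟨h0, h1⟩ := mem_Icc_of_uIcc (by norm_num) hx
      rw [sp_of_mem_left h0 (by linarith), dsp_eq_dP h0 (by linarith),
        sp_of_mem_left (by linarith) (by linarith), PdPP2_eq_pl],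
    integral_eq_plInt lPdPQ2 fun x hx => by
      obtain ⟨h0, h1⟩ := mem_Icc_of_uIcc (by norm_num) hx
      rw [sp_of_mem_left (by linarith) h1, dsp_eq_dP (by linarith) h1,
        sp_of_mem_right (by linarith) (by linarith), PdPQ2_eq_pl],
    integral_eq_plInt [] fun x hx => by
      obtain ⟨h0, h1⟩ := mem_Icc_of_uIcc (by norm_num) hx
      rw [sp_of_one_le (x := 2 * x) (by linarith), mul_zero, pl_nil]]
  simp [lPdPP2, lPdPQ2]; norm_num

/-! ### Substitution and localisation lemmas -/

/-- An integral of a function vanishing off `[A,B] ⊆ [a,b]` localises to `[A,B]`. [folklore] -/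
theorem integral_eq_integral_of_support {f : ℝ → ℝ} (hf : Continuous f) {A B a b : ℝ}
    (hA : ∀ y, y ≤ A → f y = 0) (hB : ∀ y, B ≤ y → f y = 0) (h1 : a ≤ A) (h3 : B ≤ b) :
    ∫ y in a..b, f y = ∫ y in A..B, f y := by
  have i : ∀ s t : ℝ, IntervalIntegrable f volume s t := fun s t => hf.intervalIntegrable s t
  rw [← integral_add_adjacent_intervals (i a A) (i A b), ← integral_add_adjacent_intervals (i A B) (i B b)]
  have z1 : ∫ y in a..A, f y = 0 := by
    rw [integral_congr (g := fun _ => (0:ℝ)) fun y hy => ?_, intervalIntegral.integral_zero]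
    exact hA y (mem_Icc_of_uIcc h1 hy).2
  have z2 : ∫ y in B..b, f y = 0 := by
    rw [integral_congr (g := fun _ => (0:ℝ)) fun y hy => ?_, intervalIntegral.integral_zero]
    exact hB y (mem_Icc_of_uIcc h3 hy).1
  rw [z1, z2]; ring

/-- Dyadic substitution: `∫₀¹ g(2^k x − j) dx = 2^{-k} ∫₀¹ g` for `g` vanishing off `[0,1]` and `j < 2^k`.
[folklore] -/
theorem integral_comp_dyadic {g : ℝ → ℝ} (hg : Continuous g) (h0 : ∀ y, y ≤ 0 → g y = 0)
    (h1 : ∀ y, 1 ≤ y → g y = 0) {k j : ℕ} (hj : j < 2 ^ k) :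
    ∫ x in (0:ℝ)..1, g (2 ^ k * x - j) = (2 ^ k)⁻¹ * ∫ y in (0:ℝ)..1, g y := by
  have hc : (2:ℝ) ^ k ≠ 0 := pow_ne_zero _ two_ne_zero
  rw [intervalIntegral.integral_comp_mul_sub g hc, smul_eq_mul]
  congr 1
  have hj' : (j:ℝ) + 1 ≤ 2 ^ k := by exact_mod_cast hj
  apply integral_eq_integral_of_support hg h0 h1
  · simp
  · linarith

/-- `‖spS k j‖² = 1/(30030·2^k)`. [folklore] -/
theorem integral_spS_sq {k j : ℕ} (hj : j < 2 ^ k) :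
    ∫ x in (0:ℝ)..1, spS k j x ^ 2 = 1 / (30030 * 2 ^ k) := by
  have := integral_comp_dyadic (g := fun y => sp y ^ 2) (continuous_sp.pow 2)
    (fun y hy => by simp [sp_of_nonpos hy]) (fun y hy => by simp [sp_of_one_le hy]) hj
  simp only [spS]
  rw [this, integral_sp_sq]
  field_simp

/-- `‖dspS k j‖² = 2/(77·2^k)`. [folklore] -/
theorem integral_dspS_sq {k j : ℕ} (hj : j < 2 ^ k) :
    ∫ x in (0:ℝ)..1, dspS k j x ^ 2 = 2 / (77 * 2 ^ k) := by
  have := integral_comp_dyadic (g := fun y => dsp y ^ 2) (continuous_dsp.pow 2)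
    (fun y hy => by simp [dsp_of_nonpos hy]) (fun y hy => by simp [dsp_of_one_le hy]) hj
  simp only [dspS]
  rw [this, integral_dsp_sq]
  field_simp

/-- `spS_child_eq` (1-D integral kit for B₀). [folklore] -/
theorem spS_child_eq (k j : ℕ) (x : ℝ) : spS (k + 1) (2 * j) x = sp (2 * (2 ^ k * x - j)) := by
  simp only [spS]; push_cast; ring_nf

/-- Kill constant 1: `∫₀¹ spS k j ² · spS (k+1) (2j) = M₀ / 2^k`. [folklore] -/
theorem integral_spS_sq_mul_child {k j : ℕ} (hj : j < 2 ^ k) :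
    ∫ x in (0:ℝ)..1, spS k j x ^ 2 * spS (k + 1) (2 * j) x = -1691 / 160592560128 / 2 ^ k := by
  have := integral_comp_dyadic (g := fun y => sp y ^ 2 * sp (2 * y))
    ((continuous_sp.pow 2).mul (continuous_sp.comp (continuous_const.mul continuous_id)))
    (fun y hy => by simp [sp_of_nonpos hy]) (fun y hy => by simp [sp_of_one_le hy]) hj
  simp_rw [spS_child_eq]
  simp only [spS]
  rw [this, integral_sp_sq_mul_sp_two_mul]
  field_simp

/-- Kill constant 2: `∫₀¹ spS k j · dspS k j · spS (k+1) (2j) = N₀ / 2^k`. [folklore] -/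
theorem integral_spS_dspS_child {k j : ℕ} (hj : j < 2 ^ k) :
    ∫ x in (0:ℝ)..1, spS k j x * dspS k j x * spS (k + 1) (2 * j) x = -21313 / 44609044480 / 2 ^ k := by
  have := integral_comp_dyadic (g := fun y => sp y * dsp y * sp (2 * y))
    ((continuous_sp.mul continuous_dsp).mul (continuous_sp.comp (continuous_const.mul continuous_id)))
    (fun y hy => by simp [sp_of_nonpos hy]) (fun y hy => by simp [sp_of_one_le hy]) hj
  simp_rw [spS_child_eq]
  simp only [spS, dspS]
  rw [this, integral_sp_dsp_mul_sp_two_mul]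
  field_simp

end

end Summit.NavierStokesRegularity.NavierStokesRegularity.Theorems.Haitani2025.B0
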